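import Summits.Parity.GeneralizedHardyLittlewood.Theorems.GreenTaoLevelTwoGITwoCyclicInverseTensorExists
import Summits.Parity.GeneralizedHardyLittlewood.Theorems.GreenTaoLevelTwoGITwoCyclicInverseCyclicReindex

/-!
# Route `GreenTaoLevelTwo`, crux `GITwo` (stmt-Parity-21275), line `birth`, stub `stub_cyclicInverse`:
# from a factorised correlation on `ℤ/Nℤ` to a real nilsequence correlation in the stub's shape
# (GT08a arXiv Thm. 68, last step, and the Remark after it)

Seventy-sixth helper file toward the XL stub `stub_cyclicInverse` (B. Green, T. Tao, *An inverse
theorem for the Gowers `U³(G)` norm*, arXiv:math/0503014, Thm. 68 = PEMS 51 (2008) Thm. 12.8).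
Block E17 (arXiv §12, end of the proof of Thm. 68: "Lemma 69, together with another application of
Lemma 65, confirms that the function (eq10.111) is an elementary 2-step nilfunction … This completes
the proof").  The stub `stub_cyclicInverse` asks for a REAL `1`-bounded Lipschitz `F` on a member of
the Heisenberg class and `c ≤ |(∑_{n ∈ Icc(−N/2,N/2)} f(n + h) F(gⁿx₀))/N|`.  This def-free file
performs the generic last step: if `c₀ N ≤ ‖∑_x f(x+t) G(x)‖` where `G(n mod N) = ∏ᵢ Gᵢ(n)` and every
`Gᵢ` is realised in the class (`…FactorRealisations`, `…QuadMonomial`, `…LinearMonomial`), then the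
tensor realisation (`exists_tensor_of_forall`), the re-indexing by representatives
(`sum_Icc_intCast_eq_sum_univ`, `N` odd) and the passage to real or imaginary parts
(`half_le_abs_re_sum_or_im_sum`, `isBoundedLipschitz_re/im`) give the stub's conclusion with
`c = c₀/2`:

* `exists_real_correlation_of_factorised` — the statement just described.

References: [GreenTao2008U3Inverse] arXiv:math/0503014, §12, proof of Thm. 68 (last paragraph).
-/

noncomputable section

namespace Summit.Parity.GeneralizedHardyLittlewood.GreenTaoLevelTwoGITwoCyclicInverse

open Finset Literature.NumberTheory.Sieve
open Literature.NumberTheory.Sieve.GreenTaoLevelTwo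

/-- **From a factorised correlation to the stub's real nilsequence correlation.**  Let `N` be odd,
`f : ℤ/Nℤ → ℝ`, `t : ℤ/Nℤ`, `G : ℤ/Nℤ → ℂ` with `G(n mod N) = ∏ᵢ Gᵢ(n)` (`ι` finite) where each
`Gᵢ : ℤ → ℂ` is `Ψᵢ(gᵢⁿpᵢ)` for a `1`-bounded `Mᵢ`-Lipschitz `Ψᵢ` on a member of the Heisenberg class
of `H`, and suppose `c₀ N ≤ ‖∑_x f(x+t) G(x)‖`.  Then there are a member `Z` of the class, a real
`F` with `Z.IsBoundedLipschitz (∑ Mᵢ) F`, `g`, `x₀` with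
`c₀/2 ≤ |(∑_{n ∈ Icc(−(N/2),N/2)} f(n + t) F(gⁿx₀))/N|`.
[cite: GreenTao2008U3Inverse, §12, proof of Thm. 68] -/
theorem exists_real_correlation_of_factorised (H : Nilmanifold 2) {N : ℕ} [NeZero N] (hN : Odd N)
    {ι : Type*} [Fintype ι] [DecidableEq ι] (Gfac : ι → ℤ → ℂ) (M : ι → ℝ) (hM : ∀ i, 0 ≤ M i)
    (hreal : ∀ i, ∃ Z : Nilmanifold 2, InHeisClass H Z ∧
      ∃ (Ψ : Z.G ⧸ Z.Γ → ℂ) (g : Z.G) (p : Z.G ⧸ Z.Γ),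
        (∀ y, ‖Ψ y‖ ≤ 1) ∧ (∀ y z, ‖Ψ y - Ψ z‖ ≤ M i * Z.dist y z) ∧
        ∀ n : ℤ, Ψ (g ^ n • p) = Gfac i n)
    (G : ZMod N → ℂ) (hG : ∀ n : ℤ, G (n : ZMod N) = ∏ i, Gfac i n)
    (f : ZMod N → ℝ) (t : ZMod N) {c₀ : ℝ}
    (hcorr : c₀ * N ≤ ‖∑ x : ZMod N, ((f (x + t) : ℝ) : ℂ) * G x‖) :
    ∃ Z : Nilmanifold 2, InHeisClass H Z ∧
      ∃ (g : Z.G) (x₀ : Z.G ⧸ Z.Γ) (F : Z.G ⧸ Z.Γ → ℝ),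
        Z.IsBoundedLipschitz (∑ i, M i) F ∧
          c₀ / 2 ≤ |(∑ n ∈ Finset.Icc (-((N : ℤ) / 2)) ((N : ℤ) / 2),
              f ((n : ZMod N) + t) * F (g ^ n • x₀)) / N| := by
  have hNpos : (0 : ℝ) < N := by exact_mod_cast Nat.pos_of_ne_zero (NeZero.ne N)
  obtain ⟨Z, hZ, Ψ, g, p, hb, hL, horb⟩ := exists_tensor_of_forall H Gfac M hM hreal
  -- the correlation as a sum over representatives
  have hsum : ∑ x : ZMod N, ((f (x + t) : ℝ) : ℂ) * G x =
      ∑ n ∈ Finset.Icc (-((N : ℤ) / 2)) ((N : ℤ) / 2),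
        ((f ((n : ZMod N) + t) : ℝ) : ℂ) * Ψ (g ^ n • p) := by
    rw [← sum_Icc_intCast_eq_sum_univ hN]
    refine Finset.sum_congr rfl fun n _ => ?_
    rw [hG n, horb n]
  rw [hsum] at hcorr
  -- real or imaginary part
  rcases half_le_abs_re_sum_or_im_sum _ (fun n : ℤ => f ((n : ZMod N) + t))
      (fun n : ℤ => Ψ (g ^ n • p)) hcorr with hre | him
  · refine ⟨Z, hZ, g, p, fun y => (Ψ y).re, isBoundedLipschitz_re hb hL, ?_⟩
    rw [abs_div, abs_of_pos hNpos, le_div_iff₀ hNpos]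
    have e : c₀ / 2 * N = c₀ * N / 2 := by ring
    rw [e]; exact hre
  · refine ⟨Z, hZ, g, p, fun y => (Ψ y).im, isBoundedLipschitz_im hb hL, ?_⟩
    rw [abs_div, abs_of_pos hNpos, le_div_iff₀ hNpos]
    have e : c₀ / 2 * N = c₀ * N / 2 := by ring
    rw [e]; exact him

end Summit.Parity.GeneralizedHardyLittlewood.GreenTaoLevelTwoGITwoCyclicInverse
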